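import Mathlib
import Summits.QuantumFields.YangMills.Theorems.TransportFieldVacuumRightShift
import HarnessLib

/-!
# Transport-field regularity kit, tranche 3a: the action derivative and the Feynman–Hellmann DENSITY are LINEAR in the generator and
# JOINTLY CONTINUOUS

Continuation of `TransportFieldKernelDerivative` (tranche 1) and `TransportFieldVacuumRightShift` (tranche 2).  Writing
`S'_X(U) = Σ_p −Re tr Leibniz_X(U,p)` for the explicit derivative of the Wilson action along the left shift with generator `X` at the edge `e`,
`D_X(U,V) = K_β(U,V)(β Re tr(XU_eV_e⁻¹) − (β/2)S'_X(U))` for the Feynman–Hellmann density and `FH_X(U) = λ₀⁻¹∫ D_X(U,V)Ω(V)dV` for the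
derivative of the vacuum (tranche 1 `hasDerivAt_vacuum_shift`), this file proves:
* `actionDeriv_add`, `actionDeriv_smul` — `S'` is real-linear in `X`; `continuous_actionDeriv_comp` — continuous along continuous generator/configuration fields (jointly continuous in `(X, U)`);
* `kernelDeriv_add`, `kernelDeriv_smul`, `continuous_kernelDeriv_comp` — the same for `D`;
(the integrated statements — linearity of `FH`, continuity along direction fields, additivity of the stubs' `deriv … 0` — are in the
companion `TransportFieldVacuumDerivativeLinear`, tranche 3b).
HONEST FRAMING: fixed-lattice calculus; no claim about the cruxes, K2a or the YM mass gap.  No `sorry`, no new axiom, no new definition.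
References: [cite: Creutz2022, Ch. 11]; [cite: ReedSimonIV1978, Thm. XIII.43]; [cite: Balaban1985UV3, p. 260].
-/

set_option autoImplicit false

noncomputable section

open MeasureTheory Filter Topology NormedSpace
open scoped BigOperators Matrix.Norms.Frobenius
open Literature.MathematicalPhysics.QuantumFieldTheory (GaugeConfig Site Edge Plaquette wilsonAction plaquetteHolonomy)
open Literature.MathematicalPhysics.QuantumLattice (secondCountableTopology_su2)
open Literature.MathematicalPhysics.QuantumFieldTheory.Balaban1983to89.B10Eq18SigmaSU2 (su2Coord)
open Literature.MathematicalPhysics.QuantumFieldTheory.Balaban1983to89.B10Eq18SigmaSU2Haar (expPauli coe_expPauli)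
open Summit.QuantumFields.YangMills.Theorems.EquipartitionPinsProbe.TangentSteinFiniteBeta (exists_abs_le_of_continuous)

namespace Summit.QuantumFields.YangMills.Theorems.TransportField

open Summit.QuantumFields.YangMills.Theorems.FemtoTransferGap

variable {L : ℕ} [NeZero L]

/-! ## §1 Slots -/

/-- A direct Leibniz slot is additive in the generator. [folklore] -/
theorem slot_add (c : Prop) [Decidable c] (X Y M : Matrix (Fin 2) (Fin 2) ℂ) :
    (if c then (X + Y) * M else 0 : Matrix (Fin 2) (Fin 2) ℂ) = (if c then X * M else 0) + (if c then Y * M else 0) := by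
  split_ifs <;> simp [add_mul]

/-- An inverse Leibniz slot is additive in the generator. [folklore] -/
theorem slotInv_add (c : Prop) [Decidable c] (X Y M : Matrix (Fin 2) (Fin 2) ℂ) :
    (if c then M * (-(X + Y)) else 0 : Matrix (Fin 2) (Fin 2) ℂ) = (if c then M * (-X) else 0) + (if c then M * (-Y) else 0) := by
  split_ifs
  · simp only [mul_neg, mul_add, neg_add]
  · simp

/-- A direct Leibniz slot is homogeneous in the generator. [folklore] -/
theorem slot_smul (c : Prop) [Decidable c] (r : ℂ) (X M : Matrix (Fin 2) (Fin 2) ℂ) :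
    (if c then (r • X) * M else 0 : Matrix (Fin 2) (Fin 2) ℂ) = r • (if c then X * M else 0) := by
  split_ifs <;> simp

/-- An inverse Leibniz slot is homogeneous in the generator. [folklore] -/
theorem slotInv_smul (c : Prop) [Decidable c] (r : ℂ) (X M : Matrix (Fin 2) (Fin 2) ℂ) :
    (if c then M * (-(r • X)) else 0 : Matrix (Fin 2) (Fin 2) ℂ) = r • (if c then M * (-X) else 0) := by
  split_ifs <;> simp [smul_neg]

omit [NeZero L] in
/-- A direct slot is continuous along continuous generator / configuration fields. [folklore] -/
theorem continuous_slot_comp {Z : Type*} [TopologicalSpace Z] (c : Prop) [Decidable c] (e : Edge 3 L)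
    {Xf : Z → Matrix (Fin 2) (Fin 2) ℂ} {Uf : Z → GaugeConfig 3 L SU2} (hX : Continuous Xf) (hU : Continuous Uf) :
    Continuous fun z : Z => (if c then Xf z * su2Rep (Uf z e) else 0 : Matrix (Fin 2) (Fin 2) ℂ) := by
  split_ifs
  · exact hX.mul (continuous_su2Rep.comp ((continuous_apply e).comp hU))
  · exact continuous_const

omit [NeZero L] in
/-- An inverse slot is continuous along continuous generator / configuration fields. [folklore] -/
theorem continuous_slotInv_comp {Z : Type*} [TopologicalSpace Z] (c : Prop) [Decidable c] (e : Edge 3 L)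
    {Xf : Z → Matrix (Fin 2) (Fin 2) ℂ} {Uf : Z → GaugeConfig 3 L SU2} (hX : Continuous Xf) (hU : Continuous Uf) :
    Continuous fun z : Z => (if c then su2Rep ((Uf z e)⁻¹) * (-Xf z) else 0 : Matrix (Fin 2) (Fin 2) ℂ) := by
  split_ifs
  · exact (continuous_su2Rep.comp (((continuous_apply e).comp hU).inv)).mul hX.neg
  · exact continuous_const

/-! ## §2 The action derivative `S'_X(U)`: linear in `X`, jointly continuous -/

/-- **`S'_{X+Y} = S'_X + S'_Y`.** [cite: Creutz2022, Ch. 11] -/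
theorem actionDeriv_add (e : Edge 3 L) (X Y : Matrix (Fin 2) (Fin 2) ℂ) (U : GaugeConfig 3 L SU2) :
    (∑ p : Plaquette 3 L,
        -(((((if (p.1, p.2.1.1) = e then (X + Y) * su2Rep (U e) else 0) * su2Rep (U (p.1.shift p.2.1.1, p.2.1.2)) +
              su2Rep (U (p.1, p.2.1.1)) * (if (p.1.shift p.2.1.1, p.2.1.2) = e then (X + Y) * su2Rep (U e) else 0)) *
                su2Rep ((U (p.1.shift p.2.1.2, p.2.1.1))⁻¹) +
            su2Rep (U (p.1, p.2.1.1)) * su2Rep (U (p.1.shift p.2.1.1, p.2.1.2)) *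
              (if (p.1.shift p.2.1.2, p.2.1.1) = e then su2Rep ((U e)⁻¹) * (-(X + Y)) else 0)) * su2Rep ((U (p.1, p.2.1.2))⁻¹) +
          su2Rep (U (p.1, p.2.1.1)) * su2Rep (U (p.1.shift p.2.1.1, p.2.1.2)) * su2Rep ((U (p.1.shift p.2.1.2, p.2.1.1))⁻¹) *
            (if (p.1, p.2.1.2) = e then su2Rep ((U e)⁻¹) * (-(X + Y)) else 0)).trace.re)) =
      (∑ p : Plaquette 3 L,
        -(((((if (p.1, p.2.1.1) = e then X * su2Rep (U e) else 0) * su2Rep (U (p.1.shift p.2.1.1, p.2.1.2)) +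
              su2Rep (U (p.1, p.2.1.1)) * (if (p.1.shift p.2.1.1, p.2.1.2) = e then X * su2Rep (U e) else 0)) *
                su2Rep ((U (p.1.shift p.2.1.2, p.2.1.1))⁻¹) +
            su2Rep (U (p.1, p.2.1.1)) * su2Rep (U (p.1.shift p.2.1.1, p.2.1.2)) *
              (if (p.1.shift p.2.1.2, p.2.1.1) = e then su2Rep ((U e)⁻¹) * (-X) else 0)) * su2Rep ((U (p.1, p.2.1.2))⁻¹) +
          su2Rep (U (p.1, p.2.1.1)) * su2Rep (U (p.1.shift p.2.1.1, p.2.1.2)) * su2Rep ((U (p.1.shift p.2.1.2, p.2.1.1))⁻¹) *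
            (if (p.1, p.2.1.2) = e then su2Rep ((U e)⁻¹) * (-X) else 0)).trace.re)) +
      (∑ p : Plaquette 3 L,
        -(((((if (p.1, p.2.1.1) = e then Y * su2Rep (U e) else 0) * su2Rep (U (p.1.shift p.2.1.1, p.2.1.2)) +
              su2Rep (U (p.1, p.2.1.1)) * (if (p.1.shift p.2.1.1, p.2.1.2) = e then Y * su2Rep (U e) else 0)) *
                su2Rep ((U (p.1.shift p.2.1.2, p.2.1.1))⁻¹) +
            su2Rep (U (p.1, p.2.1.1)) * su2Rep (U (p.1.shift p.2.1.1, p.2.1.2)) *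
              (if (p.1.shift p.2.1.2, p.2.1.1) = e then su2Rep ((U e)⁻¹) * (-Y) else 0)) * su2Rep ((U (p.1, p.2.1.2))⁻¹) +
          su2Rep (U (p.1, p.2.1.1)) * su2Rep (U (p.1.shift p.2.1.1, p.2.1.2)) * su2Rep ((U (p.1.shift p.2.1.2, p.2.1.1))⁻¹) *
            (if (p.1, p.2.1.2) = e then su2Rep ((U e)⁻¹) * (-Y) else 0)).trace.re)) := by
  rw [← Finset.sum_add_distrib]
  refine Finset.sum_congr rfl fun p _ => ?_
  rw [slot_add, slot_add, slotInv_add, slotInv_add]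
  simp only [add_mul, mul_add, Matrix.trace_add, Complex.add_re, neg_add]
  ring

/-- **`S'_{rX} = r S'_X`** (`r` real). [cite: Creutz2022, Ch. 11] -/
theorem actionDeriv_smul (e : Edge 3 L) (r : ℝ) (X : Matrix (Fin 2) (Fin 2) ℂ) (U : GaugeConfig 3 L SU2) :
    (∑ p : Plaquette 3 L,
        -(((((if (p.1, p.2.1.1) = e then ((r : ℂ) • X) * su2Rep (U e) else 0) * su2Rep (U (p.1.shift p.2.1.1, p.2.1.2)) +
              su2Rep (U (p.1, p.2.1.1)) * (if (p.1.shift p.2.1.1, p.2.1.2) = e then ((r : ℂ) • X) * su2Rep (U e) else 0)) *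
                su2Rep ((U (p.1.shift p.2.1.2, p.2.1.1))⁻¹) +
            su2Rep (U (p.1, p.2.1.1)) * su2Rep (U (p.1.shift p.2.1.1, p.2.1.2)) *
              (if (p.1.shift p.2.1.2, p.2.1.1) = e then su2Rep ((U e)⁻¹) * (-((r : ℂ) • X)) else 0)) * su2Rep ((U (p.1, p.2.1.2))⁻¹) +
          su2Rep (U (p.1, p.2.1.1)) * su2Rep (U (p.1.shift p.2.1.1, p.2.1.2)) * su2Rep ((U (p.1.shift p.2.1.2, p.2.1.1))⁻¹) *
            (if (p.1, p.2.1.2) = e then su2Rep ((U e)⁻¹) * (-((r : ℂ) • X)) else 0)).trace.re)) =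
      r * (∑ p : Plaquette 3 L,
        -(((((if (p.1, p.2.1.1) = e then X * su2Rep (U e) else 0) * su2Rep (U (p.1.shift p.2.1.1, p.2.1.2)) +
              su2Rep (U (p.1, p.2.1.1)) * (if (p.1.shift p.2.1.1, p.2.1.2) = e then X * su2Rep (U e) else 0)) *
                su2Rep ((U (p.1.shift p.2.1.2, p.2.1.1))⁻¹) +
            su2Rep (U (p.1, p.2.1.1)) * su2Rep (U (p.1.shift p.2.1.1, p.2.1.2)) *
              (if (p.1.shift p.2.1.2, p.2.1.1) = e then su2Rep ((U e)⁻¹) * (-X) else 0)) * su2Rep ((U (p.1, p.2.1.2))⁻¹) +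
          su2Rep (U (p.1, p.2.1.1)) * su2Rep (U (p.1.shift p.2.1.1, p.2.1.2)) * su2Rep ((U (p.1.shift p.2.1.2, p.2.1.1))⁻¹) *
            (if (p.1, p.2.1.2) = e then su2Rep ((U e)⁻¹) * (-X) else 0)).trace.re)) := by
  rw [Finset.mul_sum]
  refine Finset.sum_congr rfl fun p _ => ?_
  rw [slot_smul, slot_smul, slotInv_smul, slotInv_smul]
  simp only [Matrix.smul_mul, Matrix.mul_smul, ← smul_add, Matrix.trace_smul, smul_eq_mul, Complex.re_ofReal_mul, mul_neg]

/-- **`S'_X(U)` is continuous along continuous generator / configuration fields `z ↦ (X(z), U(z))`** (in particular jointly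
continuous in `(X, U)`). [folklore] -/
theorem continuous_actionDeriv_comp {Z : Type*} [TopologicalSpace Z] (e : Edge 3 L)
    {Xf : Z → Matrix (Fin 2) (Fin 2) ℂ} {Uf : Z → GaugeConfig 3 L SU2} (hX : Continuous Xf) (hU : Continuous Uf) :
    Continuous fun z : Z =>
      (∑ p : Plaquette 3 L,
        -(((((if (p.1, p.2.1.1) = e then (Xf z) * su2Rep ((Uf z) e) else 0) * su2Rep ((Uf z) (p.1.shift p.2.1.1, p.2.1.2)) +
              su2Rep ((Uf z) (p.1, p.2.1.1)) * (if (p.1.shift p.2.1.1, p.2.1.2) = e then (Xf z) * su2Rep ((Uf z) e) else 0)) *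
                su2Rep (((Uf z) (p.1.shift p.2.1.2, p.2.1.1))⁻¹) +
            su2Rep ((Uf z) (p.1, p.2.1.1)) * su2Rep ((Uf z) (p.1.shift p.2.1.1, p.2.1.2)) *
              (if (p.1.shift p.2.1.2, p.2.1.1) = e then su2Rep (((Uf z) e)⁻¹) * (-(Xf z)) else 0)) * su2Rep (((Uf z) (p.1, p.2.1.2))⁻¹) +
          su2Rep ((Uf z) (p.1, p.2.1.1)) * su2Rep ((Uf z) (p.1.shift p.2.1.1, p.2.1.2)) * su2Rep (((Uf z) (p.1.shift p.2.1.2, p.2.1.1))⁻¹) *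
            (if (p.1, p.2.1.2) = e then su2Rep (((Uf z) e)⁻¹) * (-(Xf z)) else 0)).trace.re)) := by
  have hd : ∀ ℓ : Edge 3 L, Continuous fun z : Z => su2Rep (Uf z ℓ) :=
    fun ℓ => continuous_su2Rep.comp ((continuous_apply ℓ).comp hU)
  have hi : ∀ ℓ : Edge 3 L, Continuous fun z : Z => su2Rep ((Uf z ℓ)⁻¹) :=
    fun ℓ => continuous_su2Rep.comp (((continuous_apply ℓ).comp hU).inv)
  refine continuous_finsetSum _ fun p _ => ?_
  have s1 := continuous_slot_comp (L := L) ((p.1, p.2.1.1) = e) e hX hU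
  have s2 := continuous_slot_comp (L := L) ((p.1.shift p.2.1.1, p.2.1.2) = e) e hX hU
  have s3 := continuous_slotInv_comp (L := L) ((p.1.shift p.2.1.2, p.2.1.1) = e) e hX hU
  have s4 := continuous_slotInv_comp (L := L) ((p.1, p.2.1.2) = e) e hX hU
  refine (Complex.continuous_re.comp (Continuous.matrix_trace ?_)).neg
  exact ((((s1.mul (hd _)).add ((hd _).mul s2)).mul (hi _)).add (((hd _).mul (hd _)).mul s3)).mul (hi _)
    |>.add ((((hd _).mul (hd _)).mul (hi _)).mul s4)

/-! ## §3 The Feynman–Hellmann density `D_X(U,V)`: linear in `X`, jointly continuous -/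

/-- **`D_{X+Y} = D_X + D_Y`.** [cite: Creutz2022, Ch. 11] -/
theorem kernelDeriv_add (β : ℝ) (e : Edge 3 L) (X Y : Matrix (Fin 2) (Fin 2) ℂ) (U V : GaugeConfig 3 L SU2) :
    (transferKernel su2Rep β U V * (β * ((X + Y) * su2Rep (U e) * su2Rep ((V e)⁻¹)).trace.re - β / 2 *
      (∑ p : Plaquette 3 L,
        -(((((if (p.1, p.2.1.1) = e then (X + Y) * su2Rep (U e) else 0) * su2Rep (U (p.1.shift p.2.1.1, p.2.1.2)) +
              su2Rep (U (p.1, p.2.1.1)) * (if (p.1.shift p.2.1.1, p.2.1.2) = e then (X + Y) * su2Rep (U e) else 0)) *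
                su2Rep ((U (p.1.shift p.2.1.2, p.2.1.1))⁻¹) +
            su2Rep (U (p.1, p.2.1.1)) * su2Rep (U (p.1.shift p.2.1.1, p.2.1.2)) *
              (if (p.1.shift p.2.1.2, p.2.1.1) = e then su2Rep ((U e)⁻¹) * (-(X + Y)) else 0)) * su2Rep ((U (p.1, p.2.1.2))⁻¹) +
          su2Rep (U (p.1, p.2.1.1)) * su2Rep (U (p.1.shift p.2.1.1, p.2.1.2)) * su2Rep ((U (p.1.shift p.2.1.2, p.2.1.1))⁻¹) *
            (if (p.1, p.2.1.2) = e then su2Rep ((U e)⁻¹) * (-(X + Y)) else 0)).trace.re)))) =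
      (transferKernel su2Rep β U V * (β * (X * su2Rep (U e) * su2Rep ((V e)⁻¹)).trace.re - β / 2 *
      (∑ p : Plaquette 3 L,
        -(((((if (p.1, p.2.1.1) = e then X * su2Rep (U e) else 0) * su2Rep (U (p.1.shift p.2.1.1, p.2.1.2)) +
              su2Rep (U (p.1, p.2.1.1)) * (if (p.1.shift p.2.1.1, p.2.1.2) = e then X * su2Rep (U e) else 0)) *
                su2Rep ((U (p.1.shift p.2.1.2, p.2.1.1))⁻¹) +
            su2Rep (U (p.1, p.2.1.1)) * su2Rep (U (p.1.shift p.2.1.1, p.2.1.2)) *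
              (if (p.1.shift p.2.1.2, p.2.1.1) = e then su2Rep ((U e)⁻¹) * (-X) else 0)) * su2Rep ((U (p.1, p.2.1.2))⁻¹) +
          su2Rep (U (p.1, p.2.1.1)) * su2Rep (U (p.1.shift p.2.1.1, p.2.1.2)) * su2Rep ((U (p.1.shift p.2.1.2, p.2.1.1))⁻¹) *
            (if (p.1, p.2.1.2) = e then su2Rep ((U e)⁻¹) * (-X) else 0)).trace.re)))) +
      (transferKernel su2Rep β U V * (β * (Y * su2Rep (U e) * su2Rep ((V e)⁻¹)).trace.re - β / 2 *
      (∑ p : Plaquette 3 L,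
        -(((((if (p.1, p.2.1.1) = e then Y * su2Rep (U e) else 0) * su2Rep (U (p.1.shift p.2.1.1, p.2.1.2)) +
              su2Rep (U (p.1, p.2.1.1)) * (if (p.1.shift p.2.1.1, p.2.1.2) = e then Y * su2Rep (U e) else 0)) *
                su2Rep ((U (p.1.shift p.2.1.2, p.2.1.1))⁻¹) +
            su2Rep (U (p.1, p.2.1.1)) * su2Rep (U (p.1.shift p.2.1.1, p.2.1.2)) *
              (if (p.1.shift p.2.1.2, p.2.1.1) = e then su2Rep ((U e)⁻¹) * (-Y) else 0)) * su2Rep ((U (p.1, p.2.1.2))⁻¹) +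
          su2Rep (U (p.1, p.2.1.1)) * su2Rep (U (p.1.shift p.2.1.1, p.2.1.2)) * su2Rep ((U (p.1.shift p.2.1.2, p.2.1.1))⁻¹) *
            (if (p.1, p.2.1.2) = e then su2Rep ((U e)⁻¹) * (-Y) else 0)).trace.re)))) := by
  rw [actionDeriv_add]
  simp only [add_mul, Matrix.trace_add, Complex.add_re]
  ring

/-- **`D_{rX} = r D_X`** (`r` real). [cite: Creutz2022, Ch. 11] -/
theorem kernelDeriv_smul (β : ℝ) (e : Edge 3 L) (r : ℝ) (X : Matrix (Fin 2) (Fin 2) ℂ) (U V : GaugeConfig 3 L SU2) :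
    (transferKernel su2Rep β U V * (β * (((r : ℂ) • X) * su2Rep (U e) * su2Rep ((V e)⁻¹)).trace.re - β / 2 *
      (∑ p : Plaquette 3 L,
        -(((((if (p.1, p.2.1.1) = e then ((r : ℂ) • X) * su2Rep (U e) else 0) * su2Rep (U (p.1.shift p.2.1.1, p.2.1.2)) +
              su2Rep (U (p.1, p.2.1.1)) * (if (p.1.shift p.2.1.1, p.2.1.2) = e then ((r : ℂ) • X) * su2Rep (U e) else 0)) *
                su2Rep ((U (p.1.shift p.2.1.2, p.2.1.1))⁻¹) +
            su2Rep (U (p.1, p.2.1.1)) * su2Rep (U (p.1.shift p.2.1.1, p.2.1.2)) *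
              (if (p.1.shift p.2.1.2, p.2.1.1) = e then su2Rep ((U e)⁻¹) * (-((r : ℂ) • X)) else 0)) * su2Rep ((U (p.1, p.2.1.2))⁻¹) +
          su2Rep (U (p.1, p.2.1.1)) * su2Rep (U (p.1.shift p.2.1.1, p.2.1.2)) * su2Rep ((U (p.1.shift p.2.1.2, p.2.1.1))⁻¹) *
            (if (p.1, p.2.1.2) = e then su2Rep ((U e)⁻¹) * (-((r : ℂ) • X)) else 0)).trace.re)))) =
      r * (transferKernel su2Rep β U V * (β * (X * su2Rep (U e) * su2Rep ((V e)⁻¹)).trace.re - β / 2 *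
      (∑ p : Plaquette 3 L,
        -(((((if (p.1, p.2.1.1) = e then X * su2Rep (U e) else 0) * su2Rep (U (p.1.shift p.2.1.1, p.2.1.2)) +
              su2Rep (U (p.1, p.2.1.1)) * (if (p.1.shift p.2.1.1, p.2.1.2) = e then X * su2Rep (U e) else 0)) *
                su2Rep ((U (p.1.shift p.2.1.2, p.2.1.1))⁻¹) +
            su2Rep (U (p.1, p.2.1.1)) * su2Rep (U (p.1.shift p.2.1.1, p.2.1.2)) *
              (if (p.1.shift p.2.1.2, p.2.1.1) = e then su2Rep ((U e)⁻¹) * (-X) else 0)) * su2Rep ((U (p.1, p.2.1.2))⁻¹) +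
          su2Rep (U (p.1, p.2.1.1)) * su2Rep (U (p.1.shift p.2.1.1, p.2.1.2)) * su2Rep ((U (p.1.shift p.2.1.2, p.2.1.1))⁻¹) *
            (if (p.1, p.2.1.2) = e then su2Rep ((U e)⁻¹) * (-X) else 0)).trace.re)))) := by
  rw [actionDeriv_smul]
  simp only [Matrix.smul_mul, Matrix.trace_smul, smul_eq_mul, Complex.re_ofReal_mul]
  ring

/-- **`D_X(U,V)` is continuous along continuous fields `z ↦ (X(z), U(z), V(z))`** (in particular jointly continuous).
[folklore] -/
theorem continuous_kernelDeriv_comp {Z : Type*} [TopologicalSpace Z] (β : ℝ) (e : Edge 3 L)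
    {Xf : Z → Matrix (Fin 2) (Fin 2) ℂ} {Uf Vf : Z → GaugeConfig 3 L SU2} (hX : Continuous Xf) (hU : Continuous Uf)
    (hV : Continuous Vf) :
    Continuous fun z : Z =>
      (transferKernel su2Rep β (Uf z) (Vf z) * (β * ((Xf z) * su2Rep ((Uf z) e) * su2Rep (((Vf z) e)⁻¹)).trace.re - β / 2 *
      (∑ p : Plaquette 3 L,
        -(((((if (p.1, p.2.1.1) = e then (Xf z) * su2Rep ((Uf z) e) else 0) * su2Rep ((Uf z) (p.1.shift p.2.1.1, p.2.1.2)) +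
              su2Rep ((Uf z) (p.1, p.2.1.1)) * (if (p.1.shift p.2.1.1, p.2.1.2) = e then (Xf z) * su2Rep ((Uf z) e) else 0)) *
                su2Rep (((Uf z) (p.1.shift p.2.1.2, p.2.1.1))⁻¹) +
            su2Rep ((Uf z) (p.1, p.2.1.1)) * su2Rep ((Uf z) (p.1.shift p.2.1.1, p.2.1.2)) *
              (if (p.1.shift p.2.1.2, p.2.1.1) = e then su2Rep (((Uf z) e)⁻¹) * (-(Xf z)) else 0)) * su2Rep (((Uf z) (p.1, p.2.1.2))⁻¹) +
          su2Rep ((Uf z) (p.1, p.2.1.1)) * su2Rep ((Uf z) (p.1.shift p.2.1.1, p.2.1.2)) * su2Rep (((Uf z) (p.1.shift p.2.1.2, p.2.1.1))⁻¹) *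
            (if (p.1, p.2.1.2) = e then su2Rep (((Uf z) e)⁻¹) * (-(Xf z)) else 0)).trace.re)))) := by
  have hK : Continuous fun z : Z => transferKernel su2Rep β (Uf z) (Vf z) := by
    have h := (continuous_transferKernel su2Rep (L := L) continuous_su2Rep β).comp (hU.prodMk hV)
    exact h
  have h1 : Continuous fun z : Z => su2Rep (Uf z e) := continuous_su2Rep.comp ((continuous_apply e).comp hU)
  have h2 : Continuous fun z : Z => su2Rep ((Vf z e)⁻¹) := continuous_su2Rep.comp (((continuous_apply e).comp hV).inv)
  have htr : Continuous fun z : Z => (Xf z * su2Rep (Uf z e) * su2Rep ((Vf z e)⁻¹)).trace.re :=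
    Complex.continuous_re.comp ((hX.mul h1).mul h2).matrix_trace
  have hS := continuous_actionDeriv_comp (L := L) e hX hU
  exact hK.mul ((continuous_const.mul htr).sub (continuous_const.mul hS))

end Summit.QuantumFields.YangMills.Theorems.TransportField

end
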